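import Mathlib
import Summits.NavierStokesRegularity.NavierStokesRegularity.Theses.EulerZoomLiouville
import Summits.NavierStokesRegularity.NavierStokesRegularity.Theorems.EulerZoomLiouvillePowerGaugeEulerLiouvilleLargeRho
import Summits.NavierStokesRegularity.NavierStokesRegularity.Theorems.EulerZoomLiouvillePowerGaugeEulerLiouvilleHelicityTubeTransport
import Summits.NavierStokesRegularity.NavierStokesRegularity.Theorems.EulerZoomLiouvillePowerGaugeEulerLiouvilleHelicityTubeStarvation
import Summits.NavierStokesRegularity.NavierStokesRegularity.Theorems.EulerZoomLiouvillePowerGaugeEulerLiouvilleHelicityTubeMember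
import Summits.NavierStokesRegularity.NavierStokesRegularity.Theorems.EulerZoomLiouvillePowerGaugeEulerLiouvilleHelicityTubeTubeTransportFree
import Summits.NavierStokesRegularity.NavierStokesRegularity.Theorems.EulerZoomLiouvillePowerGaugeEulerLiouvilleHelicityTubeStarvationFree
import Summits.NavierStokesRegularity.NavierStokesRegularity.Theorems.EulerZoomLiouvillePowerGaugeEulerLiouvilleHelicityTubeMemberFree
import Summits.NavierStokesRegularity.NavierStokesRegularity.Theorems.EulerZoomLiouvillePowerGaugeEulerLiouvilleAnchoredBudgetCutoffFlow
import Literature.Analysis.FluidPDE.ClassicalSolution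
import Literature.Analysis.FluidPDE.VectorCalculus
import HarnessLib.Audit

/-!
**rev5 (ns-idea-11 g5, 2026-08-28): STATUS — the two stratum stubs are now LANDED THEOREMS and are discharged BY NAME below
(T1 `stub_tubeTransport` := `HelicityTube.tubesPersist_of_driftingPastWith_free`; T2 `stub_helicityStarvation` := `HelicityTube.weightedHelicity_eq_zero_of_tubesPersist_free`; both gradient-free, landed by ns-sfl-p1 g4); the only `sorry` left in
this file is the declared open residue T3 `stub_helicityRest` (members outside the stratum; crux-sized, not claimed).  The composition
`PowerGaugeEulerLiouville_of` is unchanged and kernel-checked.  No summit is proved by a line.**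
-/

/-!
# Line `helicity-tube` (ideator ns-idea-11 g4, lens «complete» = program-completion) for the crux
# `EulerZoomLiouville.PowerGaugeEulerLiouville` (stmt-NavierStokesRegularity-19832)

PROGRAMME COMPLETED.  The TOPOLOGICAL-HYDRODYNAMICS programme «invariants of the vortex-line topology bound the energy from below»
— Moreau 1961 / Moffatt 1969 (J. Fluid Mech. 35: the helicity `∫_T u·ω` of every VORTEX TUBE `T` (ω tangent to `∂T`, `T` material) is a
Lagrangian invariant of classical Euler flow), Arnold 1974 / Arnold–Khesin 1998 Ch. III (energy minoration `E ≥ C|𝓗|`), Freedman–He 1991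
(Ann. Math. 134: `∫|ω|^{3/2}` bounded below by flux × asymptotic crossing number), Majda–Bertozzi Prop. 1.12 — has, on THIS crux, been used
only as a TEST: the lead lineage's `…HelicityCutoff` / `…DSSHelicity` / `…SelfSimilarHelicity` show that the TOTAL helicity of a (discretely)
self-similar member VANISHES (`H(l^{2+ρ}τ) = l^{2ρ}H(τ)`), explicitly «a necessary condition, not an exclusion», and the g0 census parked the
«helicity ledger» at the TIGHTNESS WALL (total helicity can leak to spatial infinity).  The author-named gap is the step from TEST to
EXCLUSION for NON-self-similar members.  This line takes it with Moffatt's PARTIAL helicity: the helicity of ONE coherent vortex tube is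
(i) exactly conserved WITHOUT any decay at infinity (the tube is compact and material), (ii) automatically TIGHT under a velocity envelope
(the tube cannot outrun `driftRadius`), and (iii) a FLOOR for the PRODUCT of the two gauged quantities on one ball:
`|𝓗_χ| ≤ ‖χ‖_∞ (∫_{B(R(s))}|u(s)|²)^{1/2} (∫_{B(R(s))}|curl u(s)|²)^{1/2}` (Cauchy–Schwarz) — so the `A`-gauge (`∫_{B(a)}|u(s)|² ≤ c a^{1−2ρ}`,
`−a² < s`) turns a non-zero tube helicity into an ENSTROPHY floor `𝓗_χ² /(c a^{1−2ρ})` lasting the whole drift window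
`S_a ≍ min(a², (a/M)^{1/(1−κ)})`, against the `E`-gauge budget `∫_{−a²}^{0}∫_{B(a)}|curl u|² ≤ 16 c a^{1−ρ}`:
`S_a ≲ a^{2−3ρ}`, false for large `a` iff `min(2, 1/(1−κ)) > 2 − 3ρ`, i.e. iff `κ > κ_𝓗(ρ) := (1−3ρ)/(2−3ρ)` (`< 1/2` for every `ρ > 0`;
`= 0` at `ρ = 1/3`; `= −1` at `ρ = 1/2`: there even velocity envelopes GROWING like `(−τ)^{1−0}` are allowed).

THE TUBE DATUM (typable, smooth form): at a time `τ` a `C^∞` weight `χ`, `|χ| ≤ 1`, vanishing outside `B(0,R)`, which is a FIRST INTEGRAL of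
the vorticity, `Dχ(x)[curl u(τ,x)] = 0` for all `x` (so `χ·ω` is divergence-free and `{χ ≥ c}` are vortex tubes: an «integrable» bundle of
nested invariant tori of `ω(τ)` — e.g. `χ = g(r u_θ)` for ANY axisymmetric slice with swirl, `r u_θ` being a first integral of `ω`), with
WEIGHTED HELICITY `𝓗_χ = ∫ χ ⟪u(τ), curl u(τ)⟫ ≠ 0` (layer-cake: some tube `{χ ≥ c}` has non-zero Moffatt helicity).
CONSERVATION is the tree's torus-averaged Kelvin theorem `KelvinPhysical.integral_inner_evolutionMap_eq` applied to the divergence-free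
test field `B = χ ω(τ)` — combined with the two-time Cauchy formula `FadingPast.curl_eq_fderiv_evolutionMap_apply_two_time`
(`DX B = χ∘X⁻¹ · ω(s)`) and `det DX = 1` it says precisely that the transported weight `χ_s = χ ∘ X_{s→τ}` is again a tube datum AT TIME `s`
with the SAME weighted helicity (T1 `stub_tubeTransport`).  Nobody on this crux pairs Kelvin's identity with `B ∥ ω`.

THE STRATUM `IsHelicalTubePast ρ`: classical members with a drifting far past `(T₁, M, κ)` (velocity envelope `M(−τ)^{−κ}`, `κ ∈ (κ_𝓗(ρ), 1)`,
rev2: NO gradient clause — the cutoff-field route of `stub_tubeTransport` owns the flow locally) possessing at some time `τ < T₁` a tube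
datum with `𝓗_χ ≠ 0`.
THE THEOREM OF THE LINE (T2 `stub_helicityStarvation`) is a ZERO-HELICITY LAW: on a drifting classical far past of a member EVERY coherent
vortex tube has zero helicity — an exact new constraint on every residual member (general 3D, no symmetry, no self-similarity, no Type-I
rate), which makes the stratum EMPTY (composition: contradiction).  Self-similar-rate members (`κ = 1−γ ∈ (1/2, 3/5]`) satisfy the drift
hypothesis; for them the law is consistent with CIV 2026 Remark 3.6 (`e^{(1−2γ)s}Γ(s) = Γ(0)`), which it extends off self-similarity.

RESIDUE `stub_helicityRest` = members outside the stratum (weak; no velocity envelope; or every coherent vortex tube of every drifting far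
past has zero helicity — in particular members whose vortex lines admit no compactly supported first integral) — OPEN, crux-sized, NOT
claimed.  Files only: nothing is wired into the LEAD's skeleton by this seat.  Crux 19832, rung N0 and NS regularity stay OPEN.
No summit is proved by a line.

REV4 — WHAT IS LANDED IN THE TREE (2026-08-28, prover ns-ezl-w5 g0; all `--supports stmt-19832 --as helper`, std axioms): the rev1
SUB-STRATUM `IsHelicalTubePastGrad ρ` (= the stratum PLUS rev1's clause «`∇u` bounded on every compact time interval of `(−∞,0)`, uniformly in `x`»)
is PROVED EMPTY for `0 < ρ ≤ 1/2`, BY NAME, below: `tubeTransportGrad := HelicityTube.tubesPersist_of_driftingPastWith` (T1-with-clause, p628643),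
`helicityStarvationGrad := HelicityTube.weightedHelicity_eq_zero_of_tubesPersist` (T2-with-clause, p627972), `helicalTubePastGrad_vanishes` (from
`HelicityTube.ae_eq_zero_of_gauge_of_helicalTubePast`, the sub-stratum theorem) and the ONE-HYPOTHESIS composition `PowerGaugeEulerLiouville_of_helicityRestGrad :
Sig.helicityRestGrad → crux` (kernel-checked from landed theorems only).  What stays OPEN in this file: the GRADIENT-FREE upgrades T1 `stub_tubeTransport`
(M+: the landed T1 proof with the cutoff-field flow `AnchoredBudget.cutoffFlow`, p631088, in place of the global flow, plus the local Cauchy formula) and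
T2 `stub_helicityStarvation` (S: the landed T2 proof VERBATIM with its unused binder `_hgrad` deleted), whose only effect is the smaller residue
`stub_helicityRest` (gradient-free) in place of `Sig.helicityRestGrad`; and the residue itself.
-/

open MeasureTheory Set Filter Topology Metric Real InnerProductSpace
open scoped ENNReal NNReal RealInnerProductSpace ContDiff
open Literature.Analysis Literature.Analysis.FluidPDE

set_option linter.dupNamespace false

namespace Summit.NavierStokesRegularity.NavierStokesRegularity.Cruxes.PowerGaugeEulerLiouville.HelicityTube

/-- Local abbreviation: ℝ³. -/
abbrev E3 : Type := EuclideanSpace ℝ (Fin 3)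

/-- Membership in Seregin's power-gauged ancient Euler class — verbatim the three hypotheses of the crux (same as `Birth.InClass`). -/
@[reducible] def InClass (ρ : ℝ) (u : ℝ → E3 → E3) (p : ℝ → E3 → ℝ) (H : ℝ → E3 → E3 →L[ℝ] E3)
    (c : ℝ≥0) : Prop :=
  IsSuitableWeakSolutionOn (slab (EuclideanSpace ℝ (Fin 3)) (Set.Iio 0) isOpen_Iio) 0 0 u p ∧
    HasWeakSpatialGradientOn (slab (EuclideanSpace ℝ (Fin 3)) (Set.Iio 0) isOpen_Iio) u H ∧
    (∀ a : ℝ, 0 < a →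
      ENNReal.ofReal (a ^ (2 * ρ)) * cknA a (0 : ℝ × E3) u + ENNReal.ofReal (a ^ ρ) * cknE a (0 : ℝ × E3) H +
        ENNReal.ofReal (a ^ (2 * ρ)) * cknD a (0 : ℝ × E3) p ≤ (c : ℝ≥0∞))

/-- The conclusion of the crux: `u` vanishes a.e. on the past slab. -/
@[reducible] def VanishesAE (u : ℝ → E3 → E3) : Prop :=
  Function.uncurry u =ᵐ[volume.restrict (Set.Iio (0 : ℝ) ×ˢ (Set.univ : Set E3))] 0

/-- Backward drift radius of the velocity envelope `‖u(s,·)‖_∞ ≤ M (−s)^{−κ}` between times `t₁ < t₀ < 0` (`κ < 1`):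
`M ((−t₁)^{1−κ} − (−t₀)^{1−κ}) / (1−κ)` (restated; lines do not share declarations). -/
noncomputable def driftRadius (M κ t₀ t₁ : ℝ) : ℝ :=
  M / (1 - κ) * ((-t₁) ^ (1 - κ) - (-t₀) ^ (1 - κ))

/-- A classical member with an explicit DRIFTING FAR PAST `(T₁, M, κ)`: classical Euler on `(−∞,0) × ℝ³`; `T₁ ≤ 0`, `0 ≤ M`, `κ < 1`;
velocity envelope `‖u(τ,x)‖ ≤ M(−τ)^{−κ}` for `τ < T₁` — and (rev2) NOTHING on the gradient (rev0–rev1's compact-time gradient clause only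
made the particle flow global; tube data live in `B(0,R)` and travel at most `driftRadius`, so the Literature flow kit on the Lipschitz cutoff
`ψ·u`, `ψ = 1` on `B(0, R + driftRadius + 1)`, does all the transporting, see `stub_tubeTransport`).  Same predicate as the sibling line
`stretching-budget` (rev2); NESTING (critic V34a P-rev2): its first two conjuncts are LITERALLY «anchored-budget»'s `IsAnchorablePast u p T₁`
(classical ∧ `T₁ ≤ 0`), so anchorable ⊇ drifting(M,κ) ⊇ helical-tube and one cutoff-flow lemma serves T1, K1 and C1 alike. -/
def IsDriftingPastWith (u : ℝ → E3 → E3) (p : ℝ → E3 → ℝ) (T₁ M κ : ℝ) : Prop :=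
  IsClassicalEulerSolutionOn (Set.Iio 0) 0 u p ∧ T₁ ≤ 0 ∧ 0 ≤ M ∧ κ < 1 ∧
    (∀ τ : ℝ, τ < T₁ → ∀ x : E3, ‖u τ x‖ ≤ M * (-τ) ^ (-κ))

/-- A COHERENT VORTEX-TUBE DATUM for the field `v` inside `B(0,R)`: a smooth weight `χ` with `|χ| ≤ 1`, vanishing outside `B(0,R)`, which is a
FIRST INTEGRAL of the vorticity: `Dχ(x)[curl v(x)] = 0` for every `x` (so `χ · curl v` is divergence-free and the super-level sets of `χ` are
vortex tubes of `v`). -/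
def IsTubeWeight (v : E3 → E3) (χ : E3 → ℝ) (R : ℝ) : Prop :=
  ContDiff ℝ ∞ χ ∧ (∀ x : E3, |χ x| ≤ 1) ∧ (∀ x : E3, R ≤ ‖x‖ → χ x = 0) ∧
    ∀ x : E3, fderiv ℝ χ x (curl v x) = 0

/-- The WEIGHTED (Moffatt) HELICITY of `v` against the weight `χ`: `𝓗_χ(v) = ∫ χ ⟪v, curl v⟫`. -/
noncomputable def weightedHelicity (v : E3 → E3) (χ : E3 → ℝ) : ℝ :=
  ∫ x, χ x * ⟪v x, curl v x⟫

/-- The drift threshold of the helicity race (derived, not chosen): `κ_𝓗(ρ) = (1 − 3ρ)/(2 − 3ρ)`. -/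
noncomputable def helicityDriftThreshold (ρ : ℝ) : ℝ :=
  (1 - 3 * ρ) / (2 - 3 * ρ)

/-- THE STRATUM: a drifting classical far past above the helicity drift threshold carrying, at some time, a coherent vortex tube of NON-ZERO
weighted helicity. (The theorem of the line is that this stratum is EMPTY.) -/
def IsHelicalTubePast (ρ : ℝ) (u : ℝ → E3 → E3) (p : ℝ → E3 → ℝ) : Prop :=
  ∃ T₁ M κ : ℝ, IsDriftingPastWith u p T₁ M κ ∧ helicityDriftThreshold ρ < κ ∧
    ∃ τ : ℝ, τ < T₁ ∧ ∃ (χ : E3 → ℝ) (R : ℝ), 0 < R ∧ IsTubeWeight (u τ) χ R ∧ weightedHelicity (u τ) χ ≠ 0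

/-- TUBE DATA PERSIST BACKWARD WITH THEIR HELICITY (the conclusion shape of T1): every tube datum `(χ, R)` at a time `τ < T₁` has, at every
earlier time `s < τ`, an avatar `χ'` which is a tube datum for `u(s)` inside `B(0, R + driftRadius M κ τ s)` with the SAME weighted helicity
(in truth `χ' = χ ∘ X_{s→τ}`, the weight transported by the particle flow). -/
def TubesPersist (u : ℝ → E3 → E3) (T₁ M κ : ℝ) : Prop :=
  ∀ τ : ℝ, τ < T₁ → ∀ (χ : E3 → ℝ) (R : ℝ), 0 < R → IsTubeWeight (u τ) χ R →
    ∀ s : ℝ, s < τ →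
      ∃ χ' : E3 → ℝ, IsTubeWeight (u s) χ' (R + driftRadius M κ τ s) ∧ weightedHelicity (u s) χ' = weightedHelicity (u τ) χ

/-! ## Registered stub signatures -/

/-- Signature of `stub_tubeTransport` (T1, size M — MOFFATT'S PARTIAL-HELICITY INVARIANCE, Lagrangian form): on a drifting classical far past
tube data persist backward with their helicity.  Proof (rev2, no gradient clause — size M+): run the Literature flow kit on the CUTOFF `ũ = ψ·u`,
`ψ` a smooth bump `= 1` on `B(0,R')`, `R' = R + driftRadius M κ τ s + 1`: `ũ` is jointly smooth, `ODE.IsUniformlyLipschitzOn ũ (Icc s τ)`, `X :=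
ODE.evolutionMap ũ` a global flow of diffeomorphisms (`IsUniformlyLipschitzOn.contDiff_evolutionMap`, `bijective_evolutionMap`,
`isSmoothSpaceTimeOn_evolutionMap`); CONFINEMENT `‖X(τ,s,x) − x‖ ≤ driftRadius` for `x ∈ B(0,R)` from `|ũ| ≤ |u| ≤ M(−σ)^{−κ}` (pattern of
`SwirlfreeLedger.norm_evolutionMap_sub_le` / `FadingPast.norm_evolutionMap_sub_le`), so trajectories from `B(0,R)` stay where `ψ = 1` and ARE
`u`-trajectories; `χ' := χ ∘ X(s ↦ τ)` is smooth, `|χ'| ≤ 1`, vanishes outside `B(0, R + driftRadius)`; JACOBIAN ONE along them by Liouville's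
formula `Literature.Analysis.FluidPDE.det_fderiv_evolutionMap_eq_exp_integral_divergence_of_mem` (`div ũ = 0` where `ψ = 1`); two-time CAUCHY
FORMULA `curl u(σ, X a) = DX(a) curl u(τ, a)` along the confined trajectories by linear-ODE uniqueness (both sides solve `Ẇ = ∇u(σ,X) W`;
Mathlib `ODE_solution_unique_of_mem_Icc`; the tree's global version is `FadingPast.curl_eq_fderiv_evolutionMap_apply_two_time`) ⇒ FIRST
INTEGRAL at time `s` by the chain rule; SAME HELICITY by the LOCAL Eulerian computation: `χ_σ := χ ∘ X(σ ↦ τ)` is transported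
(`∂_σχ_σ + u·∇χ_σ = 0` on its support), `h = ⟪u, ω⟫` obeys `D_σ h = div((|u|²/2 − p) ω)` (momentum + vorticity equations, classical), hence
`d/dσ ∫ χ_σ h = ∫ χ_σ div((|u|²/2 − p)ω) = −∫ (∇χ_σ·ω)(|u|²/2 − p) = 0` by the first-integral property — compact support, no global flow, no
torus-averaged Kelvin identity needed (the tree's `KelvinPhysical.integral_inner_evolutionMap_eq` / `setIntegral_image_evolutionMap` remain the
global-Lipschitz model). [cite: MajdaBertozziCUP2002, §1.6 Props. 1.10–1.12, §2.5 (2.115)–(2.117);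
ConstantinIgnatovaVicol2026Putative, §3.4.1–3.4.2] -/
def Sig.stub_tubeTransport : Prop :=
  ∀ (u : ℝ → E3 → E3) (p : ℝ → E3 → ℝ) (T₁ M κ : ℝ), IsDriftingPastWith u p T₁ M κ → TubesPersist u T₁ M κ

/-- Signature of `stub_helicityStarvation` (T2, size M — THE ZERO-HELICITY LAW): for a member of the class (`0 < ρ ≤ 1/2`) with a drifting
classical far past of exponent `κ > κ_𝓗(ρ)` on which tube data persist, EVERY tube datum at every time `τ < T₁` has zero weighted helicity.
Proof: let `h := 𝓗_χ(u(τ)) ≠ 0`; for `s < τ` the avatar `χ'_s` (T1 shape) lives in `B(0, R(s))`, `R(s) = R + driftRadius M κ τ s`, so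
`h² ≤ (∫_{B(R(s))}|u(s)|²)(∫_{B(R(s))}|curl u(s)|²)` (Cauchy–Schwarz, `|χ'| ≤ 1`); for `a` large and `s ∈ (−S_a, τ)`,
`S_a := min(a², ((1−κ)(a/2)/(M+1))^{1/(1−κ)})`, one has `R(s) ≤ a`, `−a² < s`, hence `∫_{B(a)}|u(s)|² ≤ c a^{1−2ρ}` (the `A`-gauge `cknA`, slices
continuous for classical `u`) and `∫_{B(a)}|curl u(s)|² ≥ h²/(c a^{1−2ρ})`; integrate in `s` against
`∫_{−a²}^{0}∫_{B(a)}|curl u|² ≤ 16 c a^{1−ρ}` (`CasimirFloor.lintegral_window_sq_curl_le`): `S_a − |τ| ≤ 16 c² a^{2−3ρ}/h²`, contradicting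
`min(2, 1/(1−κ)) > 2 − 3ρ ⇔ κ > helicityDriftThreshold ρ` (`exponent_race` below) as `a → ∞`. [cite: MajdaBertozziCUP2002, §1.6 Prop. 1.12;
CaffarelliKohnNirenberg1982, §2] -/
def Sig.stub_helicityStarvation : Prop :=
  ∀ ρ : ℝ, 0 < ρ → ρ ≤ 1 / 2 → ∀ (u : ℝ → E3 → E3) (p : ℝ → E3 → ℝ) (H : ℝ → E3 → E3 →L[ℝ] E3) (c : ℝ≥0),
    InClass ρ u p H c → ∀ (T₁ M κ : ℝ), IsDriftingPastWith u p T₁ M κ → helicityDriftThreshold ρ < κ → TubesPersist u T₁ M κ →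
      ∀ τ : ℝ, τ < T₁ → ∀ (χ : E3 → ℝ) (R : ℝ), 0 < R → IsTubeWeight (u τ) χ R → weightedHelicity (u τ) χ = 0

/-- Signature of `stub_helicityRest` (T3, OPEN, crux-sized — NOT claimed by this line): in the window `0 < ρ ≤ 1/2`, members OUTSIDE the stratum
(weak; no drifting far past above the threshold; or all coherent vortex tubes of all drifting far pasts non-helical) are trivial.  This is where
`birth`'s open stubs live, minus the stratum. -/
def Sig.stub_helicityRest : Prop :=
  ∀ ρ : ℝ, 0 < ρ → ρ ≤ 1 / 2 → ∀ (u : ℝ → E3 → E3) (p : ℝ → E3 → ℝ) (H : ℝ → E3 → E3 →L[ℝ] E3) (c : ℝ≥0),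
    InClass ρ u p H c → ¬ IsHelicalTubePast ρ u p → VanishesAE u

/-! ## Stubs -/

/-- STUB T1 [LANDED (rev5 wiring, ns-sfl-p1 g4): `HelicityTube.tubesPersist_of_driftingPastWith_free`
(`Theorems/EulerZoomLiouvillePowerGaugeEulerLiouvilleHelicityTubeTubeTransportFree.lean`) — the GRADIENT-FREE upgrade of `tubeTransportGrad`
(p628643) via the cutoff-field flow `AnchoredBudget.cutoffFlow` (p631088); discharged here BY NAME, no sorry]. -/
theorem stub_tubeTransport : Sig.stub_tubeTransport := by
  intro u p T₁ M κ hdp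
  exact Summit.NavierStokesRegularity.NavierStokesRegularity.Theorems.PowerGaugeEulerLiouville.HelicityTube.tubesPersist_of_driftingPastWith_free
    u p T₁ M κ hdp

/-- STUB T2 [LANDED (rev5 wiring, ns-sfl-p1 g4): `HelicityTube.weightedHelicity_eq_zero_of_tubesPersist_free`
(`Theorems/EulerZoomLiouvillePowerGaugeEulerLiouvilleHelicityTubeStarvationFree.lean`) — the GRADIENT-FREE zero-helicity law; discharged here BY
NAME, no sorry]. -/
theorem stub_helicityStarvation : Sig.stub_helicityStarvation := by
  intro ρ hρ hρ2 u p H c hcl T₁ M κ hdp hκ hT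
  exact Summit.NavierStokesRegularity.NavierStokesRegularity.Theorems.PowerGaugeEulerLiouville.HelicityTube.weightedHelicity_eq_zero_of_tubesPersist_free
    ρ hρ hρ2 u p H c hcl T₁ M κ hdp hκ hT

/-- STUB T3 [OPEN residue, not claimed; implied by the larger rev1 residue `Sig.helicityRestGrad` (`helicityRest_of_helicityRestGrad`)]. -/
theorem stub_helicityRest : Sig.stub_helicityRest := by
  sorry

/-! ## LANDED (rev4): the rev1 sub-stratum with the locally-bounded-gradient clause is PROVED EMPTY in the tree — discharged here BY NAME -/

/-- rev1's drifting past: `IsDriftingPastWith` PLUS «`∇u` bounded on every compact time interval of `(−∞,0)`, uniformly in `x`» — verbatim the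
hypothesis of the landed `HelicityTube.tubesPersist_of_driftingPastWith` (the clause makes the TRUE particle flow global). -/
def IsDriftingPastWithGrad (u : ℝ → E3 → E3) (p : ℝ → E3 → ℝ) (T₁ M κ : ℝ) : Prop :=
  IsClassicalEulerSolutionOn (Set.Iio 0) 0 u p ∧ T₁ ≤ 0 ∧ 0 ≤ M ∧ κ < 1 ∧
    (∀ τ : ℝ, τ < T₁ → ∀ x : E3, ‖u τ x‖ ≤ M * (-τ) ^ (-κ)) ∧
    (∀ t₁ t₂ : ℝ, t₁ < t₂ → t₂ < 0 → ∃ L : ℝ, ∀ τ ∈ Set.Icc t₁ t₂, ∀ x : E3, ‖fderiv ℝ (u τ) x‖ ≤ L)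

/-- The sub-stratum nests in the stratum (drop the clause). -/
theorem IsDriftingPastWithGrad.driftingPastWith {u : ℝ → E3 → E3} {p : ℝ → E3 → ℝ} {T₁ M κ : ℝ}
    (h : IsDriftingPastWithGrad u p T₁ M κ) : IsDriftingPastWith u p T₁ M κ :=
  ⟨h.1, h.2.1, h.2.2.1, h.2.2.2.1, h.2.2.2.2.1⟩

/-- rev1's stratum (= `IsHelicalTubePast` with the gradient clause). -/
def IsHelicalTubePastGrad (ρ : ℝ) (u : ℝ → E3 → E3) (p : ℝ → E3 → ℝ) : Prop :=
  ∃ T₁ M κ : ℝ, IsDriftingPastWithGrad u p T₁ M κ ∧ helicityDriftThreshold ρ < κ ∧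
    ∃ τ : ℝ, τ < T₁ ∧ ∃ (χ : E3 → ℝ) (R : ℝ), 0 < R ∧ IsTubeWeight (u τ) χ R ∧ weightedHelicity (u τ) χ ≠ 0

theorem IsHelicalTubePastGrad.helicalTubePast {ρ : ℝ} {u : ℝ → E3 → E3} {p : ℝ → E3 → ℝ}
    (h : IsHelicalTubePastGrad ρ u p) : IsHelicalTubePast ρ u p := by
  obtain ⟨T₁, M, κ, hD, hκ, hrest⟩ := h
  exact ⟨T₁, M, κ, hD.driftingPastWith, hκ, hrest⟩

/-- T1 with the clause (rev1 text of `Sig.stub_tubeTransport`). -/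
def Sig.tubeTransportGrad : Prop :=
  ∀ (u : ℝ → E3 → E3) (p : ℝ → E3 → ℝ) (T₁ M κ : ℝ), IsDriftingPastWithGrad u p T₁ M κ → TubesPersist u T₁ M κ

/-- **LANDED T1-with-clause, BY NAME** (p628643, `Theorems/EulerZoomLiouvillePowerGaugeEulerLiouvilleHelicityTubeTransport.lean`). -/
theorem tubeTransportGrad : Sig.tubeTransportGrad :=
  Summit.NavierStokesRegularity.NavierStokesRegularity.Theorems.PowerGaugeEulerLiouville.HelicityTube.tubesPersist_of_driftingPastWith

/-- T2 with the clause (rev1 text of `Sig.stub_helicityStarvation`). -/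
def Sig.helicityStarvationGrad : Prop :=
  ∀ ρ : ℝ, 0 < ρ → ρ ≤ 1 / 2 → ∀ (u : ℝ → E3 → E3) (p : ℝ → E3 → ℝ) (H : ℝ → E3 → E3 →L[ℝ] E3) (c : ℝ≥0),
    InClass ρ u p H c → ∀ (T₁ M κ : ℝ), IsDriftingPastWithGrad u p T₁ M κ → helicityDriftThreshold ρ < κ → TubesPersist u T₁ M κ →
      ∀ τ : ℝ, τ < T₁ → ∀ (χ : E3 → ℝ) (R : ℝ), 0 < R → IsTubeWeight (u τ) χ R → weightedHelicity (u τ) χ = 0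

/-- **LANDED T2-with-clause, BY NAME** (p627972, `Theorems/EulerZoomLiouvillePowerGaugeEulerLiouvilleHelicityTubeStarvation.lean`). -/
theorem helicityStarvationGrad : Sig.helicityStarvationGrad :=
  Summit.NavierStokesRegularity.NavierStokesRegularity.Theorems.PowerGaugeEulerLiouville.HelicityTube.weightedHelicity_eq_zero_of_tubesPersist

/-- **LANDED SUB-STRATUM THEOREM, BY NAME** (`…HelicityTubeMember.lean`, `HelicityTube.ae_eq_zero_of_gauge_of_helicalTubePast`): for `0 < ρ ≤ 1/2`
a member of the class on the rev1 sub-stratum vanishes a.e. (indeed the sub-stratum is empty: `HelicityTube.false_of_helicalTubePast`). -/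
theorem helicalTubePastGrad_vanishes :
    ∀ ρ : ℝ, 0 < ρ → ρ ≤ 1 / 2 → ∀ (u : ℝ → E3 → E3) (p : ℝ → E3 → ℝ) (H : ℝ → E3 → E3 →L[ℝ] E3) (c : ℝ≥0),
      InClass ρ u p H c → IsHelicalTubePastGrad ρ u p → VanishesAE u :=
  fun _ρ hρ hρ2 _u _p _H _c hin hS =>
    Summit.NavierStokesRegularity.NavierStokesRegularity.Theorems.PowerGaugeEulerLiouville.HelicityTube.ae_eq_zero_of_gauge_of_helicalTubePast
      hρ hρ2 hin.1 hin.2.1 hin.2.2 hS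

/-- The rev1 residue (LARGER than `Sig.stub_helicityRest`: members outside the SUB-stratum). Not a stub: a hypothesis of the by-name composition. -/
def Sig.helicityRestGrad : Prop :=
  ∀ ρ : ℝ, 0 < ρ → ρ ≤ 1 / 2 → ∀ (u : ℝ → E3 → E3) (p : ℝ → E3 → ℝ) (H : ℝ → E3 → E3 →L[ℝ] E3) (c : ℝ≥0),
    InClass ρ u p H c → ¬ IsHelicalTubePastGrad ρ u p → VanishesAE u

/-- The gradient-free residue is implied by the rev1 residue (the sub-stratum nests in the stratum). -/
theorem helicityRest_of_helicityRestGrad (h : Sig.helicityRestGrad) : Sig.stub_helicityRest :=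
  fun ρ hρ hρ2 u p H c hin hS => h ρ hρ hρ2 u p H c hin (fun hG => hS hG.helicalTubePast)

/-- The cutoff-field kit the gradient-free T1 runs on is in the tree (p631088): Jacobian one of the cutoff flow on STAY labels. -/
example := @Summit.NavierStokesRegularity.NavierStokesRegularity.Theorems.PowerGaugeEulerLiouville.AnchoredBudget.det_fderiv_cutoffFlow_eq_one

/-! ## Sanity checks on the stratum arithmetic (kernel-checked) -/

/-- The drift threshold is below `1/2` for every `ρ > 0` (with `ρ < 2/3`): the self-similar rates `κ = 1 − 1/(2+ρ) > 1/2` are always inside. -/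
theorem threshold_lt_half {ρ : ℝ} (hρ : 0 < ρ) (hρ2 : ρ < 2 / 3) : helicityDriftThreshold ρ < 1 / 2 := by
  unfold helicityDriftThreshold
  rw [div_lt_div_iff₀ (by linarith) (by norm_num)]
  linarith

/-- At `ρ = 1/3` the threshold is `0` (bounded velocities suffice); at the energy endpoint `ρ = 1/2` it is `−1`. -/
example : helicityDriftThreshold (1 / 3) = 0 ∧ helicityDriftThreshold (1 / 2) = -1 := by
  unfold helicityDriftThreshold; constructor <;> norm_num

/-- The exponent race behind T2: for `κ < 1` and `ρ < 2/3`, `1/(1−κ) > 2 − 3ρ ↔ κ > (1−3ρ)/(2−3ρ)`. -/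
theorem exponent_race {ρ κ : ℝ} (hκ : κ < 1) (hρ2 : ρ < 2 / 3) :
    2 - 3 * ρ < 1 / (1 - κ) ↔ helicityDriftThreshold ρ < κ := by
  unfold helicityDriftThreshold
  have h1 : 0 < 1 - κ := by linarith
  have h2 : 0 < 2 - 3 * ρ := by linarith
  rw [lt_div_iff₀ h1, div_lt_iff₀ h2]
  constructor <;> intro h <;> nlinarith

/-- Consistency with self-similar scaling (sanity): along a self-similar-rate past the product of slice energy and slice enstrophy on the
core ball scales like `(−s)^{8γ−4}` with `γ = 1/(2+ρ) < 1/2`, so a conserved non-zero tube helicity is impossible — `8γ − 4 < 0`. -/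
theorem selfSimilar_exponent_neg {ρ : ℝ} (hρ : 0 < ρ) : 8 * (1 / (2 + ρ)) - 4 < 0 := by
  rw [div_eq_mul_inv, one_mul]
  have h : (2 + ρ)⁻¹ < 1 / 2 := by
    rw [inv_lt_comm₀ (by linarith) (by norm_num)]; norm_num; linarith
  linarith

/-! ## Composition -/

/-- **Composition (kernel-checked, no sorry of its own): the three stubs give the crux BY NAME.**  On the stratum the zero-helicity law (T1+T2)
contradicts the non-zero tube helicity, so the stratum is empty; `ρ > 1/2` is the landed `powerGaugeEulerLiouville_largeRho`. -/
theorem PowerGaugeEulerLiouville_of :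
    Sig.stub_tubeTransport → Sig.stub_helicityStarvation → Sig.stub_helicityRest →
      Summit.NavierStokesRegularity.NavierStokesRegularity.Theses.EulerZoomLiouville.PowerGaugeEulerLiouville := by
  intro h1 h2 h3 ρ hρ u p H c hsw hH hc
  by_cases hhalf : 1 / 2 < ρ
  · exact
      Summit.NavierStokesRegularity.NavierStokesRegularity.Theorems.PowerGaugeEulerLiouville.powerGaugeEulerLiouville_largeRho
        ρ hhalf u p H c hsw hH hc
  · have hρ2 : ρ ≤ 1 / 2 := not_lt.mp hhalf
    by_cases hS : IsHelicalTubePast ρ u p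
    · obtain ⟨T₁, M, κ, hD, hκ, τ, hτ, χ, R, hR, hW, hne⟩ := hS
      exact absurd (h2 ρ hρ hρ2 u p H c ⟨hsw, hH, hc⟩ T₁ M κ hD hκ (h1 u p T₁ M κ hD) τ hτ χ R hR hW) hne
    · exact h3 ρ hρ hρ2 u p H c ⟨hsw, hH, hc⟩ hS

/-- **BY-NAME COMPOSITION FROM LANDED THEOREMS ONLY (rev4, kernel-checked, no sorry anywhere in its cone):** modulo the rev1 residue
`Sig.helicityRestGrad`, the crux follows from `powerGaugeEulerLiouville_largeRho` (ρ > 1/2) and the landed sub-stratum theorem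
`HelicityTube.ae_eq_zero_of_gauge_of_helicalTubePast` (0 < ρ ≤ 1/2).  The three-stub composition above says the same with the SMALLER
gradient-free residue once T1/T2 (gradient-free) are re-landed. -/
theorem PowerGaugeEulerLiouville_of_helicityRestGrad :
    Sig.helicityRestGrad →
      Summit.NavierStokesRegularity.NavierStokesRegularity.Theses.EulerZoomLiouville.PowerGaugeEulerLiouville := by
  intro h3 ρ hρ u p H c hsw hH hc
  by_cases hhalf : 1 / 2 < ρ
  · exact
      Summit.NavierStokesRegularity.NavierStokesRegularity.Theorems.PowerGaugeEulerLiouville.powerGaugeEulerLiouville_largeRho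
        ρ hhalf u p H c hsw hH hc
  · have hρ2 : ρ ≤ 1 / 2 := not_lt.mp hhalf
    by_cases hS : IsHelicalTubePastGrad ρ u p
    · exact helicalTubePastGrad_vanishes ρ hρ hρ2 u p H c ⟨hsw, hH, hc⟩ hS
    · exact h3 ρ hρ hρ2 u p H c ⟨hsw, hH, hc⟩ hS

end Summit.NavierStokesRegularity.NavierStokesRegularity.Cruxes.PowerGaugeEulerLiouville.HelicityTube
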